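import Literature.InformationTheory.QuantumCodes.CSSPhenomenologicalThreshold
import Literature.InformationTheory.QuantumCodes.MatchingDecodersExistence
import HarnessLib

/-!
# Space-time MATCHING decoders of any graphlike sector are minimum-weight space-time decoders

Topic `Literature/InformationTheory/QuantumCodes` (venture QEC, LADDER-QEC rung Q5 «toric/surface + MWPM», PARTITION row 09
"phenomenological"; qec-type-09 gen 5, item 09.PHX-MWPM). `MatchingDecoders.lean` (qec-type-09 gen 4) proves Korte–Vygen's
Theorem 12.9 for every GRAPHLIKE syndrome map `∂ = incMatrix ends` (`ends : V → Sym2 ι`, each qubit flips the two checks at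
its ends): a decoder returning geodesic realisations of a minimum-cost perfect matching of the flagged checks
(`IsMatchingDecoder m D`, any admissible link metric `m`) is a minimum-weight decoder (`IsMatchingDecoder.isMinWeight`).
`ToricCodeMatching.lean` instantiates it for the toric star record in space-time (`stLinkEnds`, hand-written). This file
does the space-time step ONCE for every graphlike sector: the `T`-round record of `CSSPhenomenologicalThreshold.lean`
(`CSSPhenom.stMatrix H T`: qubit fault `(v,t)` flips the checks of `v` in slice `t`, measurement fault `(c,t)` flips
`(c,t)` and `(c,t+1)` — "repetition code in time") of a graphlike `H = incMatrix ends` is again graphlike, with ends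

* `CSSPhenom.stEnds ends T : HistoryLoc V ι T → Sym2 (ι × Fin (T+1))` — the horizontal link `(v,t)` joins the two ends of
  `v` in slice `t`, the vertical link `(c,t)` joins `(c,t)` and `(c,t+1)` (definition, computable);
* `CSSPhenom.stMatrix_incMatrix : stMatrix (incMatrix ends) T = incMatrix (stEnds ends T)`, hence
  `stSyn = graphSyn (stEnds ends T)` and `stCycles = graphCycles (stEnds ends T)`;
* `CSSPhenom.isMinWeight_of_isMatchingDecoder_stEnds`: every space-time matching decoder (any link metric on the space-time
  checks, any tie-break, any geodesics) is a minimum-weight space-time decoder — the hypothesis of every phenomenological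
  threshold theorem of the tree; `CSSPhenom.exists_isMatchingDecoder_stEnds`: such decoders exist (extended chain metric).

Used by `Summits/Ventures/QEC/Thresholds/ToricCodeXSectorPhenomenologicalMWPM.lean` (toric PLAQUETTE record in space-time:
`H^Z = incMatrix plaqEnds`), and available for every census family with a graphlike sector.

## References

* [KorteVygen2002] B. Korte, J. Vygen, *Combinatorial Optimization*, Springer (2002), §12.2 Thm 12.9 (minimum-weight
  T-joins via minimum-weight perfect matching; Edmonds–Johnson 1973).
* [DennisEtAl2002] E. Dennis, A. Kitaev, A. Landahl, J. Preskill, J. Math. Phys. 43 (2002) 4452, arXiv:quant-ph/0110143,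
  §4.2 (the three-dimensional space-time lattice: spacelike and timelike links), §5.1 p. 19 (E_min by the matching
  algorithm in space-time).
* [DumerKovalevPryadko2015] I. Dumer, A. A. Kovalev, L. P. Pryadko, PRL 115 (2015) 050502, p. 5 (repetition code in time).
-/

namespace Literature.InformationTheory.QuantumCodes

open Finset Matrix

namespace CSSPhenom

variable {ι V : Type*}

/-- The **ends of the space-time links** of a graphlike sector with ends map `ends` monitored for `T` rounds: the
qubit-fault location `(v, t)` joins the two checks of `v` in slice `t`; the measurement-fault location `(c, t)` joins the
space-time checks `(c, t)` and `(c, t+1)`. (definition) [cite: DennisEtAl2002, §4.2 (spacelike and timelike links of the space-time lattice)] -/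
def stEnds (ends : V → Sym2 ι) (T : ℕ) : HistoryLoc V ι T → Sym2 (ι × Fin (T + 1)) :=
  Sum.elim (fun vt => (ends vt.1).map fun c => (c, vt.2.castSucc))
    (fun ct => s((ct.1, ct.2.castSucc), (ct.1, ct.2.succ)))

/-- `stEnds` on a qubit-fault location. [cite: DennisEtAl2002, §4.2 (spacelike links)] -/
@[simp] theorem stEnds_inl (ends : V → Sym2 ι) (T : ℕ) (vt : V × Fin T) :
    stEnds ends T (Sum.inl vt) = (ends vt.1).map fun c => (c, vt.2.castSucc) := rfl

/-- `stEnds` on a measurement-fault location. [cite: DennisEtAl2002, §4.2 (timelike links)] -/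
@[simp] theorem stEnds_inr (ends : V → Sym2 ι) (T : ℕ) (ct : ι × Fin T) :
    stEnds ends T (Sum.inr ct) = s((ct.1, ct.2.castSucc), (ct.1, ct.2.succ)) := rfl

/-- **The space-time boundary matrix of a graphlike sector is the incidence matrix of the space-time graph**:
`stMatrix (incMatrix ends) T = incMatrix (stEnds ends T)`. [cite: DumerKovalevPryadko2015, p. 5 (repetition code in time)]
[cite: DennisEtAl2002, §4.2–4.3 (∂ on the space-time lattice)] -/
theorem stMatrix_incMatrix [DecidableEq ι] (ends : V → Sym2 ι) (T : ℕ) :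
    stMatrix (incMatrix ends) T = incMatrix (stEnds ends T) := by
  ext ⟨c, τ⟩ ℓ
  rcases ℓ with ⟨v, t⟩ | ⟨d, t⟩
  · -- horizontal link: the two ends of `v`, placed in slice `t`
    simp only [stMatrix, incMatrix, of_apply, Sum.elim_inl, stEnds_inl]
    induction (ends v) using Sym2.ind with
    | h a b =>
      simp only [Sym2.map_mk, pairIndicator_mk, Pi.add_apply, Pi.single_apply, Prod.mk.injEq]
      by_cases hτ : τ = t.castSucc
      · subst hτ
        by_cases ha : c = a <;> by_cases hb : c = b <;> simp [ha, hb]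
      · simp [hτ]
  · -- vertical link
    simp only [stMatrix, incMatrix, of_apply, Sum.elim_inr, stEnds_inr, pairIndicator_mk, Pi.add_apply,
      Pi.single_apply, Prod.mk.injEq]
    have hne : t.castSucc ≠ t.succ := Fin.castSucc_lt_succ.ne
    by_cases hs : c = d
    · subst hs
      by_cases h1 : τ = t.castSucc
      · subst h1; simp [hne]
      · by_cases h2 : τ = t.succ
        · subst h2; simp [hne.symm]
        · simp [h1, h2]
    · simp [hs]

/-- Hence the space-time record of a graphlike sector is the graphlike boundary of `stEnds`.
[cite: DennisEtAl2002, §4.3 (∂S = ∂E)] -/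
theorem stSyn_incMatrix_eq_graphSyn [Fintype ι] [DecidableEq ι] [Fintype V] (ends : V → Sym2 ι) (T : ℕ) :
    stSyn (incMatrix ends) T = graphSyn (stEnds ends T) := by
  funext E
  simp only [stSyn, graphSyn, stMatrix_incMatrix]

/-- … and its space-time cycles are the graphlike cycles of `stEnds`. [cite: DennisEtAl2002, §4.3 (cycles)] -/
theorem stCycles_incMatrix_eq_graphCycles [Fintype ι] [DecidableEq ι] [Fintype V] (ends : V → Sym2 ι) (T : ℕ) :
    stCycles (incMatrix ends) T = graphCycles (stEnds ends T) := by
  ext z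
  simp only [stCycles, graphCycles, Set.mem_setOf_eq, stMatrix_incMatrix, graphSyn]

/-- **Space-time matching decoders are minimum-weight space-time decoders** — for EVERY graphlike sector (`H = incMatrix
ends`), every number of rounds `T`, every link metric `m` on the space-time checks and every decoder matching the flagged
space-time checks by a minimum-cost perfect matching realised by geodesics: `D.IsMinWeight (stSyn H T) (stCycles H T)
hammingNorm`, the hypothesis of the tree's phenomenological threshold theorems. (Korte–Vygen Thm 12.9 on the space-time
graph.) [cite: KorteVygen2002, §12.2 Thm 12.9] [cite: DennisEtAl2002, §5.1 p. 19 (E_min in space-time by matching)] -/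
theorem isMinWeight_of_isMatchingDecoder_stEnds [Fintype ι] [DecidableEq ι] [Fintype V] [DecidableEq V]
    {ends : V → Sym2 ι} {T : ℕ} {m : EdgeMetric (stEnds ends T)} {D : STDecoder ι V T}
    (hD : IsMatchingDecoder m D) :
    D.IsMinWeight (stSyn (incMatrix ends) T) (stCycles (incMatrix ends) T) hammingNorm := by
  rw [stSyn_incMatrix_eq_graphSyn, stCycles_incMatrix_eq_graphCycles]
  exact hD.isMinWeight

/-- **Non-vacuity**: for every graphlike sector and every `T`, a space-time matching decoder exists (link metric: the
extended chain distance of the space-time graph; some tie-break, some geodesics).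
[cite: KorteVygen2002, §12.2 Thm 12.9 with Prop 12.6] -/
theorem exists_isMatchingDecoder_stEnds [Fintype ι] [DecidableEq ι] [Fintype V] [DecidableEq V]
    (ends : V → Sym2 ι) (T : ℕ) :
    ∃ D : STDecoder ι V T, IsMatchingDecoder (extMetric (stEnds ends T)) D :=
  exists_isMatchingDecoder_extMetric

/-- Consequently every graphlike sector has, for every `T`, a space-time decoder in the matching class that is
minimum-weight (the class quantified over by the phenomenological threshold theorems is inhabited by MWPM).
[cite: KorteVygen2002, §12.2 Thm 12.9] -/
theorem exists_isMatchingDecoder_isMinWeight_st [Fintype ι] [DecidableEq ι] [Fintype V] [DecidableEq V]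
    (ends : V → Sym2 ι) (T : ℕ) :
    ∃ D : STDecoder ι V T, IsMatchingDecoder (extMetric (stEnds ends T)) D ∧
      D.IsMinWeight (stSyn (incMatrix ends) T) (stCycles (incMatrix ends) T) hammingNorm := by
  obtain ⟨D, hD⟩ := exists_isMatchingDecoder_stEnds ends T
  exact ⟨D, hD, isMinWeight_of_isMatchingDecoder_stEnds hD⟩

end CSSPhenom

end Literature.InformationTheory.QuantumCodes
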